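import Summits.QuantumFields.GaugeBoot.Certificates.SparseReducedWindowBound
import Summits.QuantumFields.GaugeBoot.Certificates.KZL2rpD4b11o5Chi3o2LoRNA
import Summits.QuantumFields.GaugeBoot.Certificates.KZL2rpD4b11o5Chi3o2LoRNB
import HarnessLib

/-!
# Aggregated equality row `KZL2rpD4b11o5Chi3o2LoRow` (gb_lean_emit_win 0.10.1)

Cell `ym-instrument` (HUMAN RULING D-0084 (2)), seat `ym-instrument-boot-lean-1`: crew (a) certificate row `SU2-D4-b11o5-kzL2rp-lin-chi22-c3o2-lower`
(`pub/ym-instrument/certs/a/files/SU2-D4/kzL2rp/`, Q-A1 R-A1.0 STEP-0 G0 record row, REF-3 CERT-PASS 2026-08-26T18:27:53Z), emitted with the INHERITED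
`pub-gaugeboot` emitter `gb_lean_emit_win 0.10.1` (kit job j258860; family tables `KZL2rpD4*` of record, family signature 981d7f3d61508310).
SCALING (bookkeeping, exact): the row's objective ℓ_{3/2} = W̄(1×2) − (3/4)·W̄(2×2) − (1/3)·ū_P has rational coefficients, while the
inherited emitter requires an integer objective row; the (problem, certificate) pair of record was therefore rescaled by 144 = 12² before emission
(`scale.py`, kit j258860: objective row ×144 = 144·y_2 − 48·y_1 − 108·y_13, equality multipliers ×144, Gram factor rows ×12, claimed bound ×144 =
144·(−0.4074032425…); eq_rows / labels / psd_blocks UNCHANGED, sha fields re-labelled `x144:<sha of record>`); the emitter's exact bound recomputation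
passed on the scaled pair, and the unscaled inequality `−0.4074… ≤ ℓ_{3/2}` is recovered in the bind file `Rows/KZL2rpD4BindB11o5Chi3o2` by dividing by 144.
HONEST FRAMING (cells `pub-gaugeboot` / `ym-instrument`): certified bounds on lattice expectations at stated coupling,
gauge group, dimension and torus size; NOT a mass gap, NOT a continuum limit, NOT a string tension;
NOT Yang–Mills-summit-bearing (barriers `FixedCouplingUltralocality`, `PerturbativeInvisibility`).
AGGREGATED-EQUALITY FORM (lead A126 (2)(c)): the 3300 equality rows of `kzL2_D4_b11o5_max_rp_G2-lin-chi22-c3o2-lower-x144` (sha256 `x144:30bc2aef839243d110c40ea326116c0089e02ab356218b87c9a743b97fe81f84`)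
enter the certificate `x144(lambda),x12…` only through `Σ_e λ_e · row_e` (λ = the certificate's exact dyadic multipliers).
That row is `a_v = n_v / RD` (numerators `RN`, data parts; common denominator `RD`; 9641 non-zeros of 10878), right-hand side
`rhsN / RD`. INTERFACE (same shape as the kz-L2-H-3D modules `KZL2HD3b…Row`): `RW = [(rhs, [(0, a_0), (1, a_1), …, (10877, a_10877)])]`
(ALL columns, in order), `rowEQ 0`, `rhsQ 0`, `aggRow`, `aggRhs`, and the cast lemmas `aggRow_cast` / `aggRhs_cast` used by the
certificate module. The certificate theorem is sound for ANY row here (it is a hypothesis); its usefulness rests on the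
lattice binding proving `Σ_v aggRow v · y_v = aggRhs` (lean2's aggregated loop-equation row + lean1's binding).
-/

namespace Summit.QuantumFields.GaugeBoot.Certificates.KZL2rpD4b11o5Chi3o2LoRow

noncomputable section

open Summit.QuantumFields.GaugeBoot.Certificates.Sparse

/-- All numerators `n_v`, `0 ≤ v < 10878` (data parts concatenated). -/
def RN : List ℤ := RNa ++ RNb

/-- The common denominator `D` of the aggregated row (71 bits). -/
def RD : ℕ := 1207346230670131200000

/-- Numerator of the right-hand side `Σ_e λ_e rhs_e = rhsN / RD`. -/
def rhsN : ℤ := 0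

set_option maxHeartbeats 0 in
/-- `RN` lists exactly 10878 numerators. -/
theorem RN_length : RN.length = 10878 := by
  decide +kernel

/-- `RD > 0`. -/
theorem RD_pos : 0 < RD := by decide

/-- The ONE aggregated row in the shared-row-table shape `[(rhs, [(v, a_v), …])]` (all columns, in order). -/
def RW : List (ℚ × List (ℕ × ℚ)) := [(((rhsN : ℤ) : ℚ) / (RD : ℚ), aggRowQ RN RD)]

/-- Equality row `e` (only `e = 0`), coefficient of `y_v`. -/
def rowEQ (e : Fin 1) (v : Fin 10878) : ℚ := sget (RW.getD e.val dRow₂).2 v.val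

/-- Right-hand side of equality row `e`. -/
def rhsQ (e : Fin 1) : ℚ := (RW.getD e.val dRow₂).1

/-- The aggregated row `a_v = Σ_e λ_e row_e[v] = n_v / RD`. -/
def aggRow (v : Fin 10878) : ℚ := rowEQ 0 v

/-- Its right-hand side `Σ_e λ_e rhs_e = rhsN / RD`. -/
def aggRhs : ℚ := rhsQ 0

/-- `aggRow v = n_v / RD` over `ℝ`. -/
theorem aggRow_cast (v : Fin 10878) : ((aggRow v : ℚ) : ℝ) = ((RN.getD v.val 0 : ℤ) : ℝ) / (RD : ℝ) :=
  cast_sget_aggRowQ RN RD v.val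

/-- `aggRhs = rhsN / RD` over `ℝ`. -/
theorem aggRhs_cast : ((aggRhs : ℚ) : ℝ) = ((rhsN : ℤ) : ℝ) / (RD : ℝ) := by
  show (((((rhsN : ℤ) : ℚ) / (RD : ℚ)) : ℚ) : ℝ) = _
  push_cast; rfl

end

end Summit.QuantumFields.GaugeBoot.Certificates.KZL2rpD4b11o5Chi3o2LoRow
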